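import Mathlib

/-!
# Crux `MonotoneSuffices` (stmt-PneNP-18026), the COVERING-DESIGN room theorem — part 1:
# the averaging argument for covering families, and a binomial ratio bound

The covering-design detector guesses its `t`-sets from a FIXED family `𝒯 = (T_i)_{i < m}` instead of
all `C(n,t)` of them. The planted side then needs a family that misses few planted sets:
`#{S : #S = k, ∀ i, ¬ T_i ⊆ S}` small. This file proves the generic averaging (probabilistic-method)
statement behind that choice, for an arbitrary relation `R` between "tests" `U` and "targets" `V`:

* `sum_card_misses` — double counting: `Σ_{f : Fin m → U} #{S ∈ V : ∀ i, ¬ R (f i) S}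
  = Σ_{S ∈ V} #{T ∈ U : ¬ R T S}^m`;
* `exists_family_few_misses` — if every target is hit by at least `P` tests, some family of `m` tests
  (repetitions allowed) misses at most `#V · (#U - P)^m / #U^m` targets;
* `exists_family_few_misses_real` — the same as `#misses ≤ #V · exp(-P m / #U)` (`(1-x)^m ≤ e^{-xm}`);
* `choose_mul_pow_le` — `C(n,t) · (k+1-t)^t ≤ n^t · C(k,t)` (so `C(n,t)/C(k,t) ≤ (n/(k+1-t))^t`);
* `le_choose_of_le_half` — `k ≤ C(k,t)` for `1 ≤ t ≤ k/2`.

Pure finite combinatorics; no circuits, no probability.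
-/

set_option linter.dupNamespace false -- `Summit.PneNP.PneNP.…`: summit = sub-problem name (D-0017 single-conjunct layout)

namespace Summit.PneNP.PneNP.Theorems.MonotoneSuffices.Cover

open Finset Real

/-! ### Families as functions `Fin m → U` -/

/-- Filtering the families `Fin m → U` by a pointwise condition gives the families over the filtered
set. [folklore] -/
theorem filter_piFinset_forall {α : Type*} [DecidableEq α] (U : Finset α) (m : ℕ) (p : α → Prop)
    [DecidablePred p] :
    (Fintype.piFinset fun _ : Fin m => U).filter (fun f => ∀ i, p (f i)) =
      Fintype.piFinset fun _ : Fin m => U.filter p := by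
  ext f
  simp only [mem_filter, Fintype.mem_piFinset, forall_and]

/-- The number of families `Fin m → U` all of whose members satisfy `p` is `#{T ∈ U : p T}^m`.
[folklore] -/
theorem card_filter_piFinset_forall {α : Type*} [DecidableEq α] (U : Finset α) (m : ℕ) (p : α → Prop)
    [DecidablePred p] :
    #((Fintype.piFinset fun _ : Fin m => U).filter fun f => ∀ i, p (f i)) = (#(U.filter p)) ^ m := by
  rw [filter_piFinset_forall, Fintype.card_piFinset, prod_const, card_univ, Fintype.card_fin]

/-! ### The averaging argument -/

/-- **Double counting the misses.** Summing, over all families `f : Fin m → U`, the number of targets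
`S ∈ V` missed by every member of `f` gives `Σ_{S ∈ V} #{T ∈ U : ¬ R T S}^m`. [folklore] -/
theorem sum_card_misses {α β : Type*} [DecidableEq α] (U : Finset α) (V : Finset β) (R : α → β → Prop)
    [∀ a b, Decidable (R a b)] (m : ℕ) :
    ∑ f ∈ Fintype.piFinset (fun _ : Fin m => U), #(V.filter fun S => ∀ i, ¬ R (f i) S) =
      ∑ S ∈ V, (#(U.filter fun T => ¬ R T S)) ^ m := by
  simp_rw [← card_filter_piFinset_forall U m, card_filter]
  exact sum_comm

/-- **A family with few misses exists (the probabilistic method for covering families).** If every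
target `S ∈ V` is hit (`R T S`) by at least `P` tests `T ∈ U` (`U` nonempty), then some family of `m`
tests `f : Fin m → U` satisfies `#{S ∈ V : ∀ i, ¬ R (f i) S} · #U^m ≤ #V · (#U - P)^m`. [folklore] -/
theorem exists_family_few_misses {α β : Type*} [DecidableEq α] (U : Finset α) (V : Finset β)
    (R : α → β → Prop) [∀ a b, Decidable (R a b)] (P m : ℕ) (hU : U.Nonempty)
    (hP : ∀ S ∈ V, P ≤ #(U.filter fun T => R T S)) :
    ∃ f ∈ Fintype.piFinset (fun _ : Fin m => U),
      #(V.filter fun S => ∀ i, ¬ R (f i) S) * #U ^ m ≤ #V * (#U - P) ^ m := by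
  have hpi : (Fintype.piFinset fun _ : Fin m => U).Nonempty :=
    Fintype.piFinset_nonempty.2 fun _ => hU
  have hcardpi : #(Fintype.piFinset fun _ : Fin m => U) = #U ^ m := by
    rw [Fintype.card_piFinset, prod_const, card_univ, Fintype.card_fin]
  -- the complement count per target
  have hneg : ∀ S ∈ V, #(U.filter fun T => ¬ R T S) ≤ #U - P := by
    intro S hS
    have h := card_filter_add_card_filter_not (s := U) (fun T => R T S)
    have hPS := hP S hS
    omega
  have hsum : ∑ f ∈ Fintype.piFinset (fun _ : Fin m => U), #(V.filter fun S => ∀ i, ¬ R (f i) S) ≤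
      #V * (#U - P) ^ m := by
    rw [sum_card_misses]
    calc ∑ S ∈ V, (#(U.filter fun T => ¬ R T S)) ^ m ≤ ∑ S ∈ V, (#U - P) ^ m :=
          sum_le_sum fun S hS => Nat.pow_le_pow_left (hneg S hS) m
      _ = #V * (#U - P) ^ m := by rw [sum_const, smul_eq_mul]
  refine exists_le_of_sum_le hpi ?_
  calc ∑ f ∈ Fintype.piFinset (fun _ : Fin m => U), #(V.filter fun S => ∀ i, ¬ R (f i) S) * #U ^ m
      = (∑ f ∈ Fintype.piFinset (fun _ : Fin m => U), #(V.filter fun S => ∀ i, ¬ R (f i) S)) * #U ^ m := by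
        rw [sum_mul]
    _ ≤ (#V * (#U - P) ^ m) * #U ^ m := Nat.mul_le_mul_right _ hsum
    _ = ∑ _f ∈ Fintype.piFinset (fun _ : Fin m => U), #V * (#U - P) ^ m := by
        rw [sum_const, smul_eq_mul, hcardpi, mul_comm]

/-- **A family with few misses exists, exponential form.** Under the hypotheses of
`exists_family_few_misses`: some `f : Fin m → U` has `#{S ∈ V : ∀ i, ¬ R (f i) S} ≤ #V · exp(-P m / #U)`.
[folklore] -/
theorem exists_family_few_misses_real {α β : Type*} [DecidableEq α] (U : Finset α) (V : Finset β)
    (R : α → β → Prop) [∀ a b, Decidable (R a b)] (P m : ℕ) (hU : U.Nonempty)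
    (hP : ∀ S ∈ V, P ≤ #(U.filter fun T => R T S)) :
    ∃ f ∈ Fintype.piFinset (fun _ : Fin m => U),
      (#(V.filter fun S => ∀ i, ¬ R (f i) S) : ℝ) ≤ #V * Real.exp (-((P : ℝ) * m / #U)) := by
  obtain ⟨f, hf, h⟩ := exists_family_few_misses U V R P m hU hP
  refine ⟨f, hf, ?_⟩
  have hU0 : (0 : ℝ) < #U := by exact_mod_cast hU.card_pos
  rcases V.eq_empty_or_nonempty with hV | hV
  · simp [hV]
  · obtain ⟨S, hS⟩ := hV
    have hPU : P ≤ #U := (hP S hS).trans (card_le_card (filter_subset _ _))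
    have hreal : (#(V.filter fun S => ∀ i, ¬ R (f i) S) : ℝ) * (#U : ℝ) ^ m ≤
        #V * ((#U : ℝ) - P) ^ m := by
      have h' : ((#(V.filter fun S => ∀ i, ¬ R (f i) S) * #U ^ m : ℕ) : ℝ) ≤
          ((#V * (#U - P) ^ m : ℕ) : ℝ) := by exact_mod_cast h
      push_cast [Nat.cast_sub hPU] at h'
      exact h'
    have hUm : (0 : ℝ) < (#U : ℝ) ^ m := by positivity
    rw [← le_div_iff₀ hUm] at hreal
    refine hreal.trans ?_
    rw [mul_div_assoc]
    refine mul_le_mul_of_nonneg_left ?_ (Nat.cast_nonneg _)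
    rw [← div_pow, sub_div, div_self hU0.ne']
    have hx0' : (0 : ℝ) ≤ 1 - P / #U := by
      rw [sub_nonneg, div_le_one hU0]; exact_mod_cast hPU
    -- `(1 - x)^m ≤ e^{-x m}` (cf. `NoStableSection.DartGame.glue_one_sub_pow_le`, whose module is not imported here)
    have h1 : 1 - (P : ℝ) / #U ≤ Real.exp (-((P : ℝ) / #U)) := by linarith [Real.add_one_le_exp (-((P : ℝ) / #U))]
    calc (1 - (P : ℝ) / #U) ^ m ≤ (Real.exp (-((P : ℝ) / #U))) ^ m := pow_le_pow_left₀ hx0' h1 m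
      _ = Real.exp (-((P : ℝ) * m / #U)) := by rw [← Real.exp_nat_mul]; congr 1; ring

/-! ### Binomial bookkeeping -/

/-- **The ratio of binomial coefficients**: `C(n,t) · (k+1-t)^t ≤ n^t · C(k,t)`, i.e.
`C(n,t)/C(k,t) ≤ (n/(k+1-t))^t`. [folklore] -/
theorem choose_mul_pow_le (n k t : ℕ) : n.choose t * (k + 1 - t) ^ t ≤ n ^ t * k.choose t := by
  calc n.choose t * (k + 1 - t) ^ t ≤ n.choose t * k.descFactorial t :=
        Nat.mul_le_mul_left _ (Nat.pow_sub_le_descFactorial k t)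
    _ = n.descFactorial t * k.choose t := by
        rw [Nat.descFactorial_eq_factorial_mul_choose, Nat.descFactorial_eq_factorial_mul_choose]; ring
    _ ≤ n ^ t * k.choose t := Nat.mul_le_mul_right _ (Nat.descFactorial_le_pow n t)

/-- `k ≤ C(k,t)` for `1 ≤ t ≤ k/2` (binomial coefficients increase up to the middle). [folklore] -/
theorem le_choose_of_le_half {k t : ℕ} (h1 : 1 ≤ t) (ht : t ≤ k / 2) : k ≤ k.choose t := by
  suffices h : ∀ j, 1 ≤ j → j ≤ k / 2 → k.choose 1 ≤ k.choose j by
    have := h t h1 ht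
    rwa [Nat.choose_one_right] at this
  intro j hj
  induction j, hj using Nat.le_induction with
  | base => intro; exact le_rfl
  | succ j hj ih =>
      intro hjk
      exact (ih (by omega)).trans (Nat.choose_le_succ_of_lt_half_left (by omega))

end Summit.PneNP.PneNP.Theorems.MonotoneSuffices.Cover

namespace Summit.PneNP.PneNP.Theorems.MonotoneSuffices.Cover

open Finset

/-- Registered sub-goal `cover_count` of stmt-PneNP-18026 (covering-design room theorem, part 1): the averaging
argument for covering families, exported verbatim. [folklore] -/
theorem cover_count :
    ∀ {α β : Type*} [DecidableEq α] (U : Finset α) (V : Finset β) (R : α → β → Prop) [∀ a b, Decidable (R a b)] (P m : ℕ), U.Nonempty → (∀ S ∈ V, P ≤ #(U.filter fun T => R T S)) → ∃ f ∈ Fintype.piFinset (fun _ : Fin m => U), (#(V.filter fun S => ∀ i, ¬ R (f i) S) : ℝ) ≤ #V * Real.exp (-((P : ℝ) * m / #U)) :=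
  fun U V R _ P m hU hP => exists_family_few_misses_real U V R P m hU hP

end Summit.PneNP.PneNP.Theorems.MonotoneSuffices.Cover
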